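import Summits.QuantumFields.YangMills.Theorems.AlphaInputsT3ACv3ChargedGlueX
import HarnessLib

/-!
# `AlphaInputsT3ACv3OuterPartX` — STRATEGY B for 2′: THE OUTER PART OF THE FREE-SEAM GLUE FROM THE ENLARGED-REGION PROFILE — (OP) `OuterPartsT3` REDUCED to r3 for the profile on the
# `Λ_i(h)` ((R3P) `ProfileReg68LevelsT3`), everything else from g2∕g3's uncharged core; so (D6X-CHARGED) ⇐ (EL) ∧ (R3P) under the record sizes — lane `pub-balaban3d`, seat alpha-2 (g4)

WHAT.  §1 ★ `profE_mem_localSmallT3_of_collar`: the inline small-loop block of g3's `core_nonempty_of_collar` for a GIVEN direction `X ∈ 𝔰𝔲(2) ∖ 0` (so that all conjuncts of an outer part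
are about the SAME configuration); ★ `outerPartT3_profE_of_collar`: under (N2′) `CollarE … K` and `4π ≤ C68`, at an admissible history the profile `profE … hX` is an outer part as soon as its
`s`-fold averages satisfy r3 on the `Λ_i(h)`, `i < k`; (R3P) `ProfileReg68LevelsT3` = that remaining row, displayed (W-free; a computation over g3's abelian (0.4)∕EML calculus — the
`s`-fold averages of `profE = gexpAt potTE` are `gexpAt (linAvgIter s potTE)` wherever the local curl thresholds hold; NOT proved here); ★★ `outerPartsT3_of_collar`; ★★
`adaptedClassNonemptyChargedT3X_of_innerLift_of_profileReg` and the (D6X) form; §2 the knit to lane A's record sizes (`collarE_T3_of_M₁_ge`, `four_pi_le_C68_of_sizes`): ★★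
`adaptedClassNonemptyT3X_of_innerLift_of_sizes`.  §3 sanity: a datum trivial on `Ω_k(h)`'s bonds has the trivial inner lift (`innerLiftT3_one`).
HONEST FRAMING.  (EL) and (R3P) are hypothesis schemas; nothing of [B10]∕[7]∕[4]'s estimates asserted; count-neutral helper toward R3 2′ (`stub_laneRecordsV3`, items 19935∕19936);
registry untouched; nothing about d = 4, the continuum, or a mass gap.

References: T. Bałaban, Commun. Math. Phys. 102 (1985) 255–275 [Balaban1985UV3] ((40)–(42) p.266, (67)–(68) p.273); CMP 98 (1985) 17–51 [Balaban1985Averaging] (Props. 1–2 p.26);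
CMP 109 (1987) 249–301 [Balaban1987RG1] ((0.4) p.253).
-/

set_option autoImplicit false

noncomputable section

namespace Summit.QuantumFields.YangMills.Theorems

open Set
open scoped Matrix.Norms.L2Operator
open Literature.MathematicalPhysics.QuantumFieldTheory.Balaban1983to89
open Literature.MathematicalPhysics.QuantumFieldTheory.Balaban1983to89.ExpMeanLog (deltaSU)
open Literature.MathematicalPhysics.QuantumFieldTheory.Balaban1983to89.T3ContinuumYM3Torus
open Literature.MathematicalPhysics.QuantumFieldTheory.Balaban1983to89.T3UnitLawDensityEML (ℰp)
open Literature.MathematicalPhysics.QuantumFieldTheory.Balaban1983to89.T3UnitScaleTilt (θBal)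
open Literature.MathematicalPhysics.QuantumFieldTheory.Balaban1983to89.T3MinimiserStabilityReduction (θBal_pos)
open Literature.MathematicalPhysics.QuantumFieldTheory.Balaban1983to89.B10Eq38TorusDomains (plaqsIn)
open Literature.MathematicalPhysics.QuantumFieldTheory.Balaban1983to89.B10Eq42TorusConstraint (bondsIn lam42)
open Literature.MathematicalPhysics.QuantumFieldTheory.Balaban1985CMP102.Setting
open Summit.QuantumFields.Balaban3D.Carriers
open Summit.QuantumFields.Balaban3D.Proofs.Primitives (AlphaConsts)
open Summit.QuantumFields.BalabanUV.T4Continuum.SubstrateBackgroundDriven (iter_one loopHol_one_cfg plaqHol_one)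
open Summit.QuantumFields.BalabanUV.T4Continuum.SubstrateBlockAvgContinuity (blockAvg_expMeanLogSU_one)
open Summit.QuantumFields.YangMills.Theorems.BalabanUVNodesN08AlphaCompactSel (regClassC)
open Summit.QuantumFields.YangMills.Theorems.BalabanUVNodesN08AlphaProfileBuild (aj aj_pos)
open Summit.QuantumFields.YangMills.Theorems.ProfileEnlarged (CollarE collarE_mono profE profE_mem_regClassC hLarge_profE dist1_plaqHol_profE_le_near)
open Summit.QuantumFields.YangMills.Theorems.LocalSmallLoop (subset_hull)

section T3

variable {F : T3Family} {𝔠 : AlphaConsts F.L (suGroupModel 2).N} {γ : ℝ} {hγ : 0 < γ} {hγ1 : γ ≤ (min 𝔠.gamma0 1) ^ 2} {K : ℕ}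

/-! ## §1 The profile is an outer part, modulo r3 on the `Λ_i(h)` -/

/-- **★ THE ENLARGED-REGION PROFILE OF A GIVEN DIRECTION LIES IN THE LOCALISED SMALL-LOOP CLASS** (`k ≤ K`, collars (N2′)): the small-loop block of g3's `core_nonempty_of_collar`, for a
fixed `X ∈ 𝔰𝔲(2) ∖ 0` (guarded hook with `α₀ := C68·max_{i ≤ k} a_i`). [cite: Balaban1985Averaging, Props. 1–2 p.26; Balaban1985UV3, (42) p.266 + (68) p.273] -/
theorem AlphaInputsT3AC.profE_mem_localSmallT3_of_collar (hN2 : CollarE (T3Scales F γ hγ (hγ1.trans (sq_min_one_le _ 𝔠.gamma0_pos)) K) 𝔠 K)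
    {k : ℕ} (hk : k ≤ K) (h : Hist (F.P K) k) {X : Matrix (Fin 2) (Fin 2) ℂ} (hX : X ∈ (suGroupModel 2).lie) (hX0 : X ≠ 0) :
    profE (T3Scales F γ hγ (hγ1.trans (sq_min_one_le _ 𝔠.gamma0_pos)) K) 𝔠 h hX ∈ AlphaInputsT3AC.localSmallT3 F 𝔠 γ hγ hγ1 K k h := by
  classical
  set S : Scales F.L := T3Scales F γ hγ (hγ1.trans (sq_min_one_le _ 𝔠.gamma0_pos)) K with hS
  have hR : CollarE S 𝔠 k := collarE_mono S 𝔠 hN2 hk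
  have hkS : k ≤ S.K := hk
  obtain ⟨im, him, hmax⟩ := Finset.exists_max_image (Finset.range (k + 1)) (aj S 𝔠) ⟨0, by simp⟩
  have himk : im ≤ k := Nat.lt_succ_iff.mp (Finset.mem_range.mp him)
  obtain ⟨hα, hα3, hα2, hδ⟩ := AlphaInputsT3AC.b7WindowNear_T3 (F := F) (𝔠 := 𝔠) (γ := γ) (hγ := hγ) (hγ1 := hγ1) (K := K) (himk.trans hk)
  refine AlphaInputsT3AC.localSmallT3_of_plaqSmall_near_reads' (𝔠 := 𝔠) (hγ1 := hγ1) hk h hα hα3 hα2 hδ fun i₀ i hi₀ hi q y hy hd => ?_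
  have hT := lam42_subset_of_le (Omega 𝔠.lane.carrier.M₁ (rcolOf S 𝔠.lane.carrier) k h) hi
  have hle := dist1_plaqHol_profE_le_near S 𝔠 hX h hX0 hkS hR hi₀ hi hT q hy hd
  refine lt_of_le_of_lt hle ?_
  have hai : aj S 𝔠 i ≤ aj S 𝔠 im := hmax i (Finset.mem_range.mpr (Nat.lt_succ_of_le hi))
  have haim : 0 < aj S 𝔠 im := aj_pos S 𝔠 (himk.trans hk)
  have hC0 : 0 < 𝔠.C68 := 𝔠.C68_pos
  have hL0 : (0 : ℝ) < ((F.L : ℝ) ^ i₀)⁻¹ := by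
    have : (0 : ℝ) < F.L := by exact_mod_cast (zero_lt_one.trans F.hL.2)
    positivity
  have hlt : 𝔠.C68 / 2 * aj S 𝔠 i < 𝔠.C68 * aj S 𝔠 im := by nlinarith
  exact mul_lt_mul_of_pos_right hlt (by positivity)

variable (F 𝔠 γ hγ hγ1 K)

/-- **(R3P) — r3 FOR THE ENLARGED-REGION PROFILE ON THE `Λ_i(h)`** (hypothesis schema, W-FREE, never asserted; the one remaining row of an outer part): for every `k ≤ K`, every admissible
history, every direction `X ∈ 𝔰𝔲(2) ∖ 0`, every `i < k`, `s ≤ i` and every level-`s` plaquette `q` with all corners in `Λ_i(h)`, the `s`-fold `blockAvg ℰp`-average of `profE … hX` has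
`|(·)(∂q) − 1| ≤ C68·θ(K−i)·L^{−2(i−s)}`.  (For `s = 0` it is g3's `dist1_plaqVar_profE_le_of_corner`; for `s ≥ 1` the averages are `gexpAt (linAvgIter s potTE)` wherever the LOCAL curl
thresholds hold — `…AbelianGlue`, `…AbelianLocal` — and the budget closes with a factor `2` since `amp_i·‖X‖ = C68·a_i·L^{−2i}/4`, `a_i = θ(K−i)`.)
[cite: Balaban1985UV3, (68) p.273; Balaban1987RG1, (0.4)+(0.11) p.253] -/
def AlphaInputsT3AC.ProfileReg68LevelsT3 (K : ℕ) : Prop :=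
  ∀ (k : ℕ), k ≤ K → ∀ (h : Hist (F.P K) k),
    Hist.Admissible 𝔠.lane.carrier.M₁ (rcolOf (T3Scales F γ hγ (hγ1.trans (sq_min_one_le _ 𝔠.gamma0_pos)) K) 𝔠.lane.carrier) k h →
    ∀ (X : Matrix (Fin 2) (Fin 2) ℂ) (hX : X ∈ (suGroupModel 2).lie), X ≠ 0 →
    ∀ i, i < k → ∀ s, s ≤ i → ∀ q : Plaq (F.P K) s, q ∈ plaqsIn s (lam42 (Omega 𝔠.lane.carrier.M₁
        (rcolOf (T3Scales F γ hγ (hγ1.trans (sq_min_one_le _ 𝔠.gamma0_pos)) K) 𝔠.lane.carrier) k h) k i) →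
      GaugeGroup.dist1 (GaugeField.plaqHol (Averaging.iter (fun l => BlockAveraging.blockAvg (P := F.P K) (j := l) ℰp) s
          (profE (T3Scales F γ hγ (hγ1.trans (sq_min_one_le _ 𝔠.gamma0_pos)) K) 𝔠 h hX)) q) ≤
        𝔠.C68 * θBal F.L γ 𝔠.b₀ 𝔠.p₀ (K - i) * (((F.L : ℝ) ^ (i - s))⁻¹) ^ 2

variable {F 𝔠 γ hγ hγ1 K}

/-- **★ THE PROFILE IS AN OUTER PART** at an admissible history (`k ≤ K`, collars (N2′), `4π ≤ C68`), GIVEN r3 for its averages on the `Λ_i(h)`: loop-smallness at the bonds of the `Λ_i(h)`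
from `profE_mem_localSmallT3_of_collar` (read bonds lie in the g2 cone), the read-local (68) set from `profE_mem_regClassC` + `regClassC ⊆ reg68LocalSet`, (67)-largeness from
`hLarge_profE`. [cite: Balaban1985UV3, (67)–(68) p.273] -/
theorem AlphaInputsT3AC.outerPartT3_profE_of_collar (hN2 : CollarE (T3Scales F γ hγ (hγ1.trans (sq_min_one_le _ 𝔠.gamma0_pos)) K) 𝔠 K) (hC : 4 * Real.pi ≤ 𝔠.C68)
    {k : ℕ} (hk : k ≤ K) {h : Hist (F.P K) k}
    (hh : Hist.Admissible 𝔠.lane.carrier.M₁ (rcolOf (T3Scales F γ hγ (hγ1.trans (sq_min_one_le _ 𝔠.gamma0_pos)) K) 𝔠.lane.carrier) k h)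
    {X : Matrix (Fin 2) (Fin 2) ℂ} (hX : X ∈ (suGroupModel 2).lie) (hX0 : X ≠ 0)
    (hr3 : ∀ i, i < k → ∀ s, s ≤ i → ∀ q : Plaq (F.P K) s, q ∈ plaqsIn s (lam42 (Omega 𝔠.lane.carrier.M₁
        (rcolOf (T3Scales F γ hγ (hγ1.trans (sq_min_one_le _ 𝔠.gamma0_pos)) K) 𝔠.lane.carrier) k h) k i) →
      GaugeGroup.dist1 (GaugeField.plaqHol (Averaging.iter (fun l => BlockAveraging.blockAvg (P := F.P K) (j := l) ℰp) s
          (profE (T3Scales F γ hγ (hγ1.trans (sq_min_one_le _ 𝔠.gamma0_pos)) K) 𝔠 h hX)) q) ≤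
        𝔠.C68 * θBal F.L γ 𝔠.b₀ 𝔠.p₀ (K - i) * (((F.L : ℝ) ^ (i - s))⁻¹) ^ 2) :
    AlphaInputsT3AC.OuterPartT3 F 𝔠 γ hγ hγ1 K k h (profE (T3Scales F γ hγ (hγ1.trans (sq_min_one_le _ 𝔠.gamma0_pos)) K) 𝔠 h hX) := by
  set S : Scales F.L := T3Scales F γ hγ (hγ1.trans (sq_min_one_le _ 𝔠.gamma0_pos)) K with hS
  have hR : CollarE S 𝔠 k := collarE_mono S 𝔠 hN2 hk
  have hkS : k ≤ S.K := hk
  have hloc := AlphaInputsT3AC.profE_mem_localSmallT3_of_collar (hγ1 := hγ1) hN2 hk h hX hX0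
  refine ⟨fun i' hi' i hii' c hc x => ?_, ?_, ?_, hr3⟩
  · -- the read bonds of `Λ_{i'}(h)` lie in the g2 cone, where `localSmallT3` bounds the loop variables
    exact hloc i (by omega) c (subset_hull _ (i + 1) ⟨i', hii', hi'.le, hc⟩) x
  · exact AlphaInputsT3AC.regClassC_subset_reg68LocalSet (𝔠 := 𝔠) (hγ1 := hγ1) hk hh (profE_mem_regClassC S 𝔠 h hX hX0 hkS hR)
  · exact hLarge_profE S 𝔠 h hX hX0 hkS hR (AlphaInputsT3AC.smallOK_T3 (𝔠 := 𝔠) (hγ1 := hγ1) hk) hC hh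

/-- **★★ (OP) FROM THE COLLAR ROW, `4π ≤ C68` AND (R3P).** [cite: Balaban1985UV3, (67)–(68) p.273] -/
theorem AlphaInputsT3AC.outerPartsT3_of_collar (hN2 : CollarE (T3Scales F γ hγ (hγ1.trans (sq_min_one_le _ 𝔠.gamma0_pos)) K) 𝔠 K) (hC : 4 * Real.pi ≤ 𝔠.C68)
    (hR3 : AlphaInputsT3AC.ProfileReg68LevelsT3 F 𝔠 γ hγ hγ1 K) : AlphaInputsT3AC.OuterPartsT3 F 𝔠 γ hγ hγ1 K := by
  intro k hk h hh _
  obtain ⟨X, hX, hX0⟩ := BalabanUVNodesN08AlphaProfileGroupSU.exists_ne_zero_mem_lie_su (N := 2) le_rfl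
  exact ⟨_, AlphaInputsT3AC.outerPartT3_profE_of_collar (hγ1 := hγ1) hN2 hC hk hh hX hX0 (hR3 k hk h hh X hX hX0)⟩

/-- **★★ (D6X-CHARGED) FROM (EL), (R3P), THE COLLAR ROW AND `4π ≤ C68`.** [cite: Balaban1985UV3, (40)–(42) p.266 + (67)–(68) p.273] -/
theorem AlphaInputsT3AC.adaptedClassNonemptyChargedT3X_of_innerLift_of_profileReg
    (hN2 : CollarE (T3Scales F γ hγ (hγ1.trans (sq_min_one_le _ 𝔠.gamma0_pos)) K) 𝔠 K) (hC : 4 * Real.pi ≤ 𝔠.C68)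
    (hEL : AlphaInputsT3AC.InnerExactLiftT3 F 𝔠 γ hγ hγ1 K) (hR3 : AlphaInputsT3AC.ProfileReg68LevelsT3 F 𝔠 γ hγ hγ1 K) :
    AlphaInputsT3AC.AdaptedClassNonemptyChargedT3X F 𝔠 γ hγ hγ1 K :=
  AlphaInputsT3AC.adaptedClassNonemptyChargedT3X_of_innerLift (hγ1 := hγ1) hEL (AlphaInputsT3AC.outerPartsT3_of_collar (hγ1 := hγ1) hN2 hC hR3)

/-- **★★ (D6X) FROM (EL), (R3P), THE COLLAR ROW AND `4π ≤ C68`.** [cite: Balaban1985UV3, (40)–(42) p.266 + (67)–(68) p.273] -/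
theorem AlphaInputsT3AC.adaptedClassNonemptyT3X_of_innerLift_of_profileReg
    (hN2 : CollarE (T3Scales F γ hγ (hγ1.trans (sq_min_one_le _ 𝔠.gamma0_pos)) K) 𝔠 K) (hC : 4 * Real.pi ≤ 𝔠.C68)
    (hEL : AlphaInputsT3AC.InnerExactLiftT3 F 𝔠 γ hγ hγ1 K) (hR3 : AlphaInputsT3AC.ProfileReg68LevelsT3 F 𝔠 γ hγ hγ1 K) :
    AlphaInputsT3AC.AdaptedClassNonemptyT3X F 𝔠 γ hγ hγ1 K :=
  AlphaInputsT3AC.adaptedClassNonemptyT3X_of_charged_of_collar hN2 hC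
    (AlphaInputsT3AC.adaptedClassNonemptyChargedT3X_of_innerLift_of_profileReg (hγ1 := hγ1) hN2 hC hEL hR3)

/-! ## §2 The knit to the record sizes -/

/-- **★★ (D6X) FROM (EL), (R3P) AND THE RECORD SIZES `7L + 3 ≤ M₁`, `1 ≤ 2B₃`, `4B₃L²·avgWindowFactor ≤ C68`** (g3's `collarE_T3_of_M₁_ge`, `four_pi_le_C68_of_sizes`): at the ∃𝔠 level
of 2′ the only displayed kinematic content left is (EL) — the inner exact regular lift of the datum — and the W-free computation (R3P). [cite: Balaban1985UV3, (7) p.257, (40)–(42) p.266, (68) p.273] -/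
theorem AlphaInputsT3AC.adaptedClassNonemptyT3X_of_innerLift_of_sizes (hM₁ : 7 * F.L + 3 ≤ 𝔠.M₁) (hB₃ : 1 ≤ 2 * 𝔠.B₃)
    (hC : 4 * 𝔠.B₃ * (F.L : ℝ) ^ 2 * avgWindowFactor F.L ≤ 𝔠.C68)
    (hEL : AlphaInputsT3AC.InnerExactLiftT3 F 𝔠 γ hγ hγ1 K) (hR3 : AlphaInputsT3AC.ProfileReg68LevelsT3 F 𝔠 γ hγ hγ1 K) :
    AlphaInputsT3AC.AdaptedClassNonemptyT3X F 𝔠 γ hγ hγ1 K :=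
  AlphaInputsT3AC.adaptedClassNonemptyT3X_of_innerLift_of_profileReg
    (AlphaInputsT3AC.collarE_T3_of_M₁_ge (hγ := hγ) (hγ1 := hγ1) (K := K) hM₁) (AlphaInputsT3AC.four_pi_le_C68_of_sizes (𝔠 := 𝔠) hB₃ hC) hEL hR3

/-! ## §3 Sanity: the trivial datum has the trivial inner lift -/

/-- **A DATUM EQUAL TO `1` ON THE BONDS OF `Ω_k(h)` HAS THE TRIVIAL INNER LIFT `U = 1`** (the averaging of record fixes `1`, its loop variables and plaquettes are `1`; the r3 budget is
non-negative). [folklore] -/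
theorem AlphaInputsT3AC.innerLiftT3_one {k : ℕ} (h : Hist (F.P K) k) (W : GaugeField (F.P K) k (Matrix.specialUnitaryGroup (Fin 2) ℂ))
    (hW : ∀ b : PBond (F.P K) k, b ∈ bondsIn k (Omega 𝔠.lane.carrier.M₁
      (rcolOf (T3Scales F γ hγ (hγ1.trans (sq_min_one_le _ 𝔠.gamma0_pos)) K) 𝔠.lane.carrier) k h k) → W b = 1) :
    AlphaInputsT3AC.InnerLiftT3 F 𝔠 γ hγ hγ1 K k h W 1 := by
  have h1 : ∀ s, Averaging.iter (fun l => BlockAveraging.blockAvg (P := F.P K) (j := l) ℰp) s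
      (1 : GaugeField (F.P K) 0 (Matrix.specialUnitaryGroup (Fin 2) ℂ)) = 1 :=
    iter_one _ fun l => blockAvg_expMeanLogSU_one (n := Fin 2) (F.P K) l
  have hγ1' : γ ≤ 1 := hγ1.trans (sq_min_one_le _ 𝔠.gamma0_pos)
  have hL1 : 1 ≤ F.L := by have := F.hL.2; omega
  refine ⟨fun i _ c _ x => ?_, fun b hb => ?_, fun s _ q _ => ?_⟩
  · rw [h1 i, loopHol_one_cfg, GaugeGroup.dist1_one]
    have := ℰp.δ_pos; positivity
  · rw [h1 k, hW b hb]; rfl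
  · rw [h1 s, plaqHol_one, GaugeGroup.dist1_one]
    have hθ := θBal_pos hL1 hγ hγ1' 𝔠.b₀_pos 𝔠.p₀ (K - k)
    have hC := 𝔠.C68_pos
    positivity

end T3

end Summit.QuantumFields.YangMills.Theorems

end
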